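import Summits.CriticalPhenomena.PercolationContinuityZ3.Theorems.Transplant.SkelPhiRootBridgeKits
import Summits.CriticalPhenomena.PercolationContinuityZ3.Theorems.Transplant.SkelPhiRunExitTable
import HarnessLib

/-!
# N1 (the `{±1}` node), (R) column ((R5) re-version under (L3); NEG-SCOPE B.15 (ii)): THE ROOT-FRAME KIT CLAUSE WITH ORIENTATION-AWARE EXITS —
# `kitClause_rootFrameG` / `hkits_bridgeG` = `kitClause_rootFrame` / `hkits_bridge` (p288924 / p290473) with the exit pieces ABSTRACT (`Pex`, placement `hPex` below the shell
# lines of the root-frame side forms `rootSideU`), and the root-frame exit TABLE **`pexRO`** = p1-g11's orientation-aware pieces (`SkelPhiRunExitTable`, p293503): raw-side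
# piece `pexRaw` on the x-sides, level-side piece `pexLev` at the trivial shear `(1, 0)` on the y-sides, with **`pexRO_spec`** from `rawSideU_place`/`levSide_place` +
# `pexRaw_goal`/`pexLev_goal` under the ledger floors only (`A = M_z + 2`, `22M_z+58 ≤ n_s`, `|h_s| ≤ 10 n_s`, `24M_z+64 ≤ ℓ_s`) — so the kit pair may live in either orientation

builds on p205010 (kernel theorem, internal audit signed; external expert review pending) — nothing in this file uses p205010; nothing here is a claim about the open node.
Lane `prim-bschramm`, seat `prim-bschramm-p3` (gen 9; design owner + (R) owner); helper file (`--supports stmt-CriticalPhenomena-4575 --as helper`).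
[cite: KozmaNitzan2024, §4 Lemma 10 (pp. 17–21), p. 28] [cite: MartineauTassion2017, §3.2, §4.3 Lemma 4.2]
-/

noncomputable section

open scoped Classical

namespace Summit.CriticalPhenomena.PercolationContinuityZ3.Theorems.Transplant

namespace Skelφ

open MeasureTheory
open Literature.Probability.Percolation Literature.Probability.LatticeModels SimpleGraph KNLevels
open Literature.Barriers.CriticalPhenomena (graphBall graphBall_finite mem_graphBall_self graphBall_mono)
open Skel (winGraph winGraph_adj winGraph_le KitGeom)
open SkelI (tanOff tanTgt tanTgt_mem)
open Literature.Probability.Percolation.KozmaNitzan.Cells (oth oth_ne eq_oth_of_ne oth_oth)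
open ChainPlanar

variable {V : Type} [DecidableEq V] {G : SimpleGraph V} [G.LocallyFinite] {φ : V → Site 2}

/-! ## §1 The kit clause with abstract exit pieces -/

/-- **THE KIT CLAUSE OF A ROOT-FRAME WINDOW LEVEL, ABSTRACT EXIT PIECES** (`Pex` with the placement `hPex` below the shell lines of the root-frame side forms). Level box `[lo − j, hi + j]` of the frame `rootFrame φ t σ` around `w₀` (radius `R`);
kit constants `P` (`P.A = nz + 2`, `1 ≤ P.N`) with the placement numbers; short region `Rg`, zone family `Λc` (seed level `kz`, zone level `nz`), short
piece data `Q` (pieces inside `Rg`, exit rooms); per contact: far ⇒ inner neighbour in the target; near ⇒ a face vertex in the target or the three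
Step-IV inputs at the kit centre (zone, the exit link of the side's piece, the route datum). [cite: KozmaNitzan2024, §4 Lemma 10 (pp. 17–21)] -/
theorem kitClause_rootFrameG [Countable V] {types : Finset V} (hlipφ : Lip G φ) (hstep : Steps G φ) (hfr : Frames G φ types) (hκ : CylConn G φ types)
    {Δ : ℕ} (hΔ : ∀ v, G.degree v ≤ Δ) {q : unitInterval} {δ : ℝ} (hδ : 0 < δ)
    -- the root frame
    (t : V) {σ : ℤ} (hσ : σ = 1 ∨ σ = -1)
    -- the level box and the window
    {lo hi : Site 2} {j : ℕ} {w₀ : V} {R : ℕ}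
    -- kit constants
    (P : ApronPrm) {nz Rs Kmax KCmax rs cS cU : ℕ} (hPN : 1 ≤ P.N) (hA : P.A = (nz : ℤ) + 2)
    (hd1 : P.W + P.ℓ ≤ P.d) (hD1 : P.W + P.ℓ + P.d + 2 ≤ shellD P) (hD2 : P.ℓ + Rs + P.d + 3 ≤ shellD P) (hDρ : Rs + 1 ≤ shellD P)
    (hℓ : 1 ≤ P.ℓ) (hW : Rs + P.ℓ ≤ P.W) (hKmax : shellD P + P.W ≤ Kmax) (hKCmax : shellD P + nz + 1 ≤ KCmax)
    (hR' : cylRadMax G φ types P.ℓ (Rs + KCmax + (P.W + Kmax)) ≤ P.R')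
    (hwide : ∀ i, (lo - (j : Site 2)) i + 2 * tanOff P.ℓs P.M ≤ (hi + (j : Site 2)) i)
    (hdw : ∀ i, (lo - (j : Site 2)) i + (P.d + 2 : ℕ) ≤ (hi + (j : Site 2)) i)
    (hDw : ∀ i, (lo - (j : Site 2)) i + ((shellD P + 1 + P.d + KCmax + Rs : ℕ) : ℤ) ≤ (hi + (j : Site 2)) i)
    (hT : (P.W : ℤ) + Kmax + P.ℓ + 1 ≤ tanOff P.ℓs P.M) (hT' : (shellD P : ℤ) + KCmax + Rs ≤ tanOff P.ℓs P.M)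
    (hr₀ : P.N * (tanOff P.ℓs P.M + 2) + P.N * P.d + (P.W + Kmax + P.R') + (KCmax + Rs) ≤ P.r₀) (hR : P.r₀ ≤ R)
    (hrs : 2 * (1 + P.N * (tanOff P.ℓs P.M + 2) + P.N * P.d + (P.W + Kmax + P.R') + (KCmax + Rs)) ≤ rs)
    (hcS : (P.N + 1) * (tanOff P.ℓs P.M + 1) + (P.N + 1) * P.d + (2 * P.W + 1) * (Kmax + 1) * (Δ + 1) ^ P.R' ≤ cS)
    -- the short region, the zone family, the short pieces
    (Rg : V → Finset V) (hRg : ∀ c, ∀ u ∈ Rg c, u ∈ graphBall G c Rs) (hRgcard : ∀ c, (Rg c).card ≤ cU) (hcU1 : 1 ≤ cU)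
    (Λc : V → ℕ → Finset V) (kz : ℕ) (hkn : ∀ c, Λc c kz ⊆ Λc c nz) (hΛ : ∀ c, ∀ v ∈ Λc c nz, v ∈ Rg c ∧ φ v - φ c ∈ box 2 nz)
    (Pex : Fin 2 → ℤˣ → V → Finset V)
    (hPex : ∀ (i : Fin 2) (σ₀ : ℤˣ) (c : V), ∀ v ∈ Pex i σ₀ c, v ∈ Rg c ∧
      (rootSideU (φ := φ) t hσ (lo - (j : Site 2)) (hi + (j : Site 2)) i σ₀).lin (φ v) + P.A +
        ((rootSideU (φ := φ) t hσ (lo - (j : Site 2)) (hi + (j : Site 2)) i σ₀).s : ℤ) *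
          coef (rootSideU (φ := φ) t hσ (lo - (j : Site 2)) (hi + (j : Site 2)) i σ₀).cα
            (rootSideU (φ := φ) t hσ (lo - (j : Site 2)) (hi + (j : Site 2)) i σ₀).cβ
            (rootSideU (φ := φ) t hσ (lo - (j : Site 2)) (hi + (j : Site 2)) i σ₀).a ≤
      (rootSideU (φ := φ) t hσ (lo - (j : Site 2)) (hi + (j : Site 2)) i σ₀).lin (φ c))
    -- the level's source/support, the weighting, the region and the target
    (k : ℕ) (o : V) (Sfin : Finset V) {Wt : Sym2 V → unitInterval} {D T : Finset V} (hWD : IsSubbox (winGraph G w₀ R) Wt q D)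
    (hXD : winLevel G (rootFrame φ t σ) w₀ R lo hi j ⊆ D) {N : ℕ} (hN : k * (Δ + 1) ^ (2 * rs) ≤ N)
    (hk : (1 - (q : ℝ) ^ (1 + Δ * cS + cS * cU)) ^ k ≤ δ)
    -- per contact
    (hfar : ∀ x ∈ outerBoundary (winGraph G w₀ R) (winLevel G (rootFrame φ t σ) w₀ R lo hi j),
      ¬ IsNear G (rootFrame φ t σ) (lo - (j : Site 2)) (hi + (j : Site 2)) P w₀ R x →
      ctY G (rootFrame φ t σ) w₀ R (lo - (j : Site 2)) (hi + (j : Site 2)) x ∈ T)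
    (hnear' : ∀ x ∈ outerBoundary (winGraph G w₀ R) (winLevel G (rootFrame φ t σ) w₀ R lo hi j),
      IsNear G (rootFrame φ t σ) (lo - (j : Site 2)) (hi + (j : Site 2)) P w₀ R x →
      (∃ u ∈ ctFace G (rootSideU (φ := φ) t hσ (lo - (j : Site 2)) (hi + (j : Site 2))) Rg P w₀ R x, u ∈ T) ∨
      (1 - δ ^ 2 < (bondPercolation G q).real
          (UniqZone.zone G (Λc (ctCtr G (rootSideU (φ := φ) t hσ (lo - (j : Site 2)) (hi + (j : Site 2))) P w₀ R x)) kz nz) ∧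
        1 - δ ^ 2 < (bondPercolation G q).real
          (linkIn (↑(Rg (ctCtr G (rootSideU (φ := φ) t hσ (lo - (j : Site 2)) (hi + (j : Site 2))) P w₀ R x)) : Set V)
            (Λc (ctCtr G (rootSideU (φ := φ) t hσ (lo - (j : Site 2)) (hi + (j : Site 2))) P w₀ R x) kz)
            (Pex (ctDir G (rootFrame φ t σ) w₀ R (lo - (j : Site 2)) (hi + (j : Site 2)) x).1
              (ctDir G (rootFrame φ t σ) w₀ R (lo - (j : Site 2)) (hi + (j : Site 2)) x).2
              (ctCtr G (rootSideU (φ := φ) t hσ (lo - (j : Site 2)) (hi + (j : Site 2))) P w₀ R x))) ∧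
        ∃ Qt Ft : Finset V, Ft ⊆ T ∧ Qt ⊆ D ∧
          Disjoint Ft (Λc (ctCtr G (rootSideU (φ := φ) t hσ (lo - (j : Site 2)) (hi + (j : Site 2))) P w₀ R x) nz) ∧
          1 - δ ^ 2 < (prodBernoulli Wt).real (linkIn (↑Qt : Set V)
            (Λc (ctCtr G (rootSideU (φ := φ) t hσ (lo - (j : Site 2)) (hi + (j : Site 2))) P w₀ R x) kz) Ft))) :
    ∃ (σ' : SData V) (S : Finset V), SHyp (winLData G (rootFrame φ t σ) w₀ R lo hi o Sfin) j σ' ∧ σ'.N ≤ N ∧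
      (1 - (q : ℝ) ^ σ'.sB) ^ σ'.k ≤ δ ∧ S ⊆ (winLData G (rootFrame φ t σ) w₀ R lo hi o Sfin).X j ∧ S ⊆ D ∧
      (∀ x ∈ σ'.K, ∀ e ∈ σ'.seed x, e ∉ wireSet (↑S : Set V)) ∧ (∀ x ∈ σ'.K, σ'.face x ⊆ S) ∧
      (∀ x ∈ σ'.K, 1 - 3 * δ ≤ (prodBernoulli Wt).real {ω | ∃ u ∈ σ'.face x,
        1 - δ < (prodBernoulli (pinW Wt (wireSet (↑S : Set V)) ω)).real (⋃ t ∈ T, openConnIn (↑D : Set V) u t)}) := by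
  set SF := rootSideU (φ := φ) t hσ (lo - (j : Site 2)) (hi + (j : Site 2)) with hSF
  have hU1 : (1 : ℤ) ≤ 1 := le_rfl
  have haff : ∀ (i : Fin 2) (σ₀ : ℤˣ), (SF i σ₀).IsAffine 1 ((fun _ _ => (1 : ℤ)) i σ₀) := fun i σ₀ => by
    rw [hSF]; exact rootSideU_isAffine t hσ _ _ i σ₀
  have hC : ∀ (i : Fin 2) (σ₀ : ℤˣ), ((1 : ℕ) : ℤ) ≤ (fun _ _ => (1 : ℤ)) i σ₀ := fun _ _ => by simp
  have hU : (1 : ℤ) ≤ ((0 + 1 : ℕ) : ℤ) * (1 : ℕ) := by simp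
  have hA' : P.A = ((nz + 1 : ℕ) : ℤ) * 1 + 1 := by rw [hA]; push_cast; ring
  have hA0 : 0 ≤ P.A := by rw [hA]; positivity
  have hdD : P.d + 2 ≤ shellD P := by omega
  have hKmax' : (shellD P + P.W) * (0 + 1) ≤ Kmax := by simpa using hKmax
  have hKCmax' : (shellD P + nz + 1) * (0 + 1) ≤ KCmax := by simpa using hKCmax
  refine kitClauseA' SF Rg (lip_rootFrame hlipφ t hσ) ((qStepsN_of_steps (steps_rootFrame hstep t hσ)).mono hPN) hlipφ hstep hfr hκ hΔ hδ hℓ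
    hwide hdw hdD hDw hDρ
    (hbelow_of_affine SF haff hU1 P hD1) (habove_of_affine SF haff hU1 P hd1) (hK_of_affine SF haff hU1 P (le_refl 1) hC hU hKmax')
    (fun i σ₀ z hz _ => hKC_of_affine SF haff hU1 P (le_refl 1) hC hU hA' hKCmax' i σ₀ z hz) (hθA_of_affine SF haff hU1 P hA0 hdD)
    (hAz_of_affine SF haff P hA') (hcap_of_affine SF haff hU1 P hD2) (compat_rootFrame t hσ) hT hT' hW hR' hRg hRgcard hcU1 hr₀ hR hrs hcS Λc hkn hΛ
    Pex (by rw [hSF]; exact hPex) k o Sfin hWD hXD hN hk hfar hnear'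

/-! ## §2 The root-frame exit table (p1-g11's raw/level tables at `U = 1`, trivial shear) -/

variable (G φ) in
/-- **The exit table of a root-frame level kit**: x-sides (`i = 0`) — p1-g11's raw-side piece `pexRaw` (`e = σ₀σ`); y-sides (`i = 1`) — the level-side piece `pexLev`
at the trivial shear `(n, h) = (1, 0)` (`e = σ₀`); both in the kit pair's own orientation `Q.oS c`. [cite: MartineauTassion2017, §3.2] -/
def pexRO (Q : ShortPcO V) (Mz : ℕ) (A σ : ℤ) (i : Fin 2) (σ₀ : ℤˣ) (c : V) : Finset V :=
  if i = 0 then pexRaw G φ Q Mz ((σ₀ : ℤ) * σ) c else pexLev G φ Q 1 0 A (σ₀ : ℤ) c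

omit [DecidableEq V] in
/-- The root-frame table's pieces lie in the short prism. [folklore] -/
theorem pexRO_subset (Q : ShortPcO V) (Mz : ℕ) (A σ : ℤ) (i : Fin 2) (σ₀ : ℤˣ) (c : V) : pexRO G φ Q Mz A σ i σ₀ c ⊆ RgO G φ Q c := by
  unfold pexRO
  split_ifs
  · exact pexRaw_subset Q Mz _ c
  · exact pexLev_subset Q 1 0 A _ c

omit [DecidableEq V] in
/-- **The root-frame table satisfies `hPex` for the root-frame side forms** under the ledger floors (`A = M_z + 2`, `22M_z + 58 ≤ n_s`, `|h_s| ≤ 10 n_s`,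
`24M_z + 64 ≤ ℓ_s`). [this work] -/
theorem pexRO_spec (t : V) {σ : ℤ} (hσ : σ = 1 ∨ σ = -1) (Lo Hi : Site 2) (Q : ShortPcO V) {A : ℤ} {Mz : ℕ} (hA : A = (Mz : ℤ) + 2)
    (hnS : ∀ c, 22 * Mz + 58 ≤ Q.nS c) (hκS : ∀ c, |Q.hS c| ≤ 10 * (Q.nS c : ℤ)) (hℓ : ∀ c, 24 * Mz + 64 ≤ Q.ℓS c)
    (i : Fin 2) (σ₀ : ℤˣ) (c : V) : ∀ v ∈ pexRO G φ Q Mz A σ i σ₀ c, v ∈ RgO G φ Q c ∧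
      (rootSideU (φ := φ) t hσ Lo Hi i σ₀).lin (φ v) + A +
        ((rootSideU (φ := φ) t hσ Lo Hi i σ₀).s : ℤ) * coef (rootSideU (φ := φ) t hσ Lo Hi i σ₀).cα
          (rootSideU (φ := φ) t hσ Lo Hi i σ₀).cβ (rootSideU (φ := φ) t hσ Lo Hi i σ₀).a ≤
      (rootSideU (φ := φ) t hσ Lo Hi i σ₀).lin (φ c) := by
  intro v hv
  refine ⟨pexRO_subset Q Mz A σ i σ₀ c hv, ?_⟩
  have hA1 : A = (Mz + 1 : ℕ) * (1 : ℤ) + 1 := by rw [hA]; push_cast; ring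
  have hA' : A = (Mz + 1 : ℕ) * (((1 : ℕ) : ℤ) + |(0 : ℤ)|) + 1 := by rw [hA]; push_cast; simp; ring
  have he : (σ₀ : ℤ) * σ = 1 ∨ (σ₀ : ℤ) * σ = -1 := by
    rcases Int.units_eq_one_or σ₀ with h | h <;> rcases hσ with h' | h' <;> simp [h, h']
  have he1 : (σ₀ : ℤ) = 1 ∨ (σ₀ : ℤ) = -1 := by rcases Int.units_eq_one_or σ₀ with h | h <;> simp [h]
  unfold pexRO at hv
  fin_cases i <;> simp only [Fin.zero_eta, Fin.isValue, Fin.mk_one, if_true, show ¬ ((1 : Fin 2) = 0) by decide, if_false] at hv ⊢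
  · exact rawSideU_place (ψ := rootFrame φ t σ) t σ hσ (U := 1) le_rfl Lo Hi 0 σ₀ (fun w => by rw [rootFrame_apply_zero]) hA1
      (pexRaw_goal he (hnS c) (hℓ c) hv)
  · have hg := pexLev_goal (nL := 1) (hL := 0) he1 le_rfl (by simp) (hnS c) (hκS c) (hℓ c) hA' hv
    exact levSide_place (ψ := rootFrame φ t σ) t (le_refl 1) 0 1 (Or.inl rfl) Lo Hi 1 σ₀ (rootFrame_one_eq_lev t σ) (by simpa using hg)

/-! ## §3 The bridge-step kit clause with abstract exit pieces -/

/-- **THE KIT CLAUSE OF A BRIDGE-STEP LEVEL FROM THE INPUTS AT EVERY CENTRE, ABSTRACT EXIT PIECES** (`hkits₁` of `rootOblTWAt_of_bridge` at its only step `k = 0`, level `j`):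
the window is the root frame `rootFrame φ t σ` around `w₀` (radius `R`), the level box is `[B₀lo − j, B₀hi + j]`, the region `Dr ⊇ Win([regionLo, regionHi])`
carries the subbox weighting `Wt`, the target `T ⊇ Win([core1Lo, core1Hi]) ∪ (far part of the level)`; inputs at every centre `c`: the zone `(M_u)`, the eight
short exit links (pieces `pexR`), and the BRIDGE event — region `Qb c ⊆ B(c, R_b)` read inside `rootFrame c ± pr`, piece `Fb c ⊆ Qb c` read inside
`rootFrame c + [dlo, dhi]`, off the zone `Λ c Mz` (read by `bridgeSets_*` from `Λ c Mz ⊆ cyl φ c Mz`). [cite: KozmaNitzan2024, §4 Lemma 10 (pp. 17–21), p. 28] [cite: MartineauTassion2017, §4.3 Lemma 4.2] -/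
theorem hkits_bridgeG [Countable V] {types : Finset V} (hlipφ : Lip G φ) (hstep : Steps G φ) (hfr : Frames G φ types) (hκ : CylConn G φ types)
    {Δ : ℕ} (hΔ : ∀ v, G.degree v ≤ Δ) {q : unitInterval} {δ : ℝ} (hδ : 0 < δ)
    -- the root frame and the bridge frame
    (t : V) {σ : ℤ} (hσ : σ = 1 ∨ σ = -1) (B : BridgePrm) {j : ℕ} {w₀ : V} {R r Rb Mz : ℕ}
    -- kit constants
    (P : ApronPrm) {Rs Kmax KCmax rs cS cU : ℕ} (hPN : 1 ≤ P.N) (hA : P.A = (Mz : ℤ) + 2)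
    (hd1 : P.W + P.ℓ ≤ P.d) (hD1 : P.W + P.ℓ + P.d + 2 ≤ shellD P) (hD2 : P.ℓ + Rs + P.d + 3 ≤ shellD P) (hDρ : Rs + 1 ≤ shellD P)
    (hℓ : 1 ≤ P.ℓ) (hW : Rs + P.ℓ ≤ P.W) (hKmax : shellD P + P.W ≤ Kmax) (hKCmax : shellD P + Mz + 1 ≤ KCmax)
    (hR' : cylRadMax G φ types P.ℓ (Rs + KCmax + (P.W + Kmax)) ≤ P.R')
    (hwide : ∀ i, (B.B₀lo - (j : Site 2)) i + 2 * tanOff P.ℓs P.M ≤ (B.B₀hi + (j : Site 2)) i)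
    (hdw : ∀ i, (B.B₀lo - (j : Site 2)) i + (P.d + 2 : ℕ) ≤ (B.B₀hi + (j : Site 2)) i)
    (hDw : ∀ i, (B.B₀lo - (j : Site 2)) i + ((shellD P + 1 + P.d + KCmax + Rs : ℕ) : ℤ) ≤ (B.B₀hi + (j : Site 2)) i)
    (hT : (P.W : ℤ) + Kmax + P.ℓ + 1 ≤ tanOff P.ℓs P.M) (hT' : (shellD P : ℤ) + KCmax + Rs ≤ tanOff P.ℓs P.M)
    (hr₀ : P.N * (tanOff P.ℓs P.M + 2) + P.N * P.d + (P.W + Kmax + P.R') + (KCmax + Rs) ≤ P.r₀) (hR : P.r₀ ≤ R)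
    (hrs : 2 * (1 + P.N * (tanOff P.ℓs P.M + 2) + P.N * P.d + (P.W + Kmax + P.R') + (KCmax + Rs)) ≤ rs)
    (hcS : (P.N + 1) * (tanOff P.ℓs P.M + 1) + (P.N + 1) * P.d + (2 * P.W + 1) * (Kmax + 1) * (Δ + 1) ^ P.R' ≤ cS)
    -- the reach of the kit centre: inside the `R′`-enlargement, and `B(w₀, R − r)` with `R_b ≤ r ≤ R`
    (hE : j + (P.N * (tanOff P.ℓs P.M + 1) + P.N * P.d + KCmax) ≤ B.R')
    (hreach : r + (P.N * (tanOff P.ℓs P.M + 1) + P.N * P.d + KCmax) ≤ P.r₀) (hr : Rb ≤ r) (hrR : r ≤ R)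
    -- the short region, the zone family, the short pieces
    (Rg : V → Finset V) (hRg : ∀ c, ∀ u ∈ Rg c, u ∈ graphBall G c Rs) (hRgcard : ∀ c, (Rg c).card ≤ cU) (hcU1 : 1 ≤ cU)
    (Λc : V → ℕ → Finset V) (kz : ℕ) (hkn : ∀ c, Λc c kz ⊆ Λc c Mz) (hΛ : ∀ c, ∀ v ∈ Λc c Mz, v ∈ Rg c ∧ φ v - φ c ∈ box 2 Mz)
    (Pex : Fin 2 → ℤˣ → V → Finset V)
    (hPex : ∀ (i : Fin 2) (σ₀ : ℤˣ) (c : V), ∀ v ∈ Pex i σ₀ c, v ∈ Rg c ∧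
      (rootSideU (φ := φ) t hσ (B.B₀lo - (j : Site 2)) (B.B₀hi + (j : Site 2)) i σ₀).lin (φ v) + P.A +
        ((rootSideU (φ := φ) t hσ (B.B₀lo - (j : Site 2)) (B.B₀hi + (j : Site 2)) i σ₀).s : ℤ) *
          coef (rootSideU (φ := φ) t hσ (B.B₀lo - (j : Site 2)) (B.B₀hi + (j : Site 2)) i σ₀).cα
            (rootSideU (φ := φ) t hσ (B.B₀lo - (j : Site 2)) (B.B₀hi + (j : Site 2)) i σ₀).cβ
            (rootSideU (φ := φ) t hσ (B.B₀lo - (j : Site 2)) (B.B₀hi + (j : Site 2)) i σ₀).a ≤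
      (rootSideU (φ := φ) t hσ (B.B₀lo - (j : Site 2)) (B.B₀hi + (j : Site 2)) i σ₀).lin (φ c))
    -- the bridge stride at every centre: region, piece, readings in the root frame, off the zone
    (Qb Fb : V → Finset V)
    (hQb : ∀ c, ∀ w ∈ Qb c, w ∈ graphBall G c Rb ∧
      rootFrame φ t σ w ∈ Finset.Icc (rootFrame φ t σ c - ((B.pr : ℕ) : Site 2)) (rootFrame φ t σ c + ((B.pr : ℕ) : Site 2)))
    (hFb : ∀ c, ∀ w ∈ Fb c, w ∈ Qb c ∧ rootFrame φ t σ w ∈ Finset.Icc (rootFrame φ t σ c + B.dlo) (rootFrame φ t σ c + B.dhi))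
    (hFZ : ∀ c, Disjoint (Fb c) (Λc c Mz))
    -- the level's source/support, the weighting on the region, the target
    (kk : ℕ) (o : V) (Sfin : Finset V) {Wt : Sym2 V → unitInterval} {Dr T : Finset V} (hWD : IsSubbox (winGraph G w₀ R) Wt q Dr)
    (hPD : Win G (rootFrame φ t σ) w₀ (Finset.Icc B.regionLo B.regionHi) R ⊆ Dr)
    (hXD : winLevel G (rootFrame φ t σ) w₀ R B.B₀lo B.B₀hi j ⊆ Dr)
    (hPT : Win G (rootFrame φ t σ) w₀ (Finset.Icc B.core1Lo B.core1Hi) R ⊆ T)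
    (hfarT : ∀ v ∈ winLevel G (rootFrame φ t σ) w₀ R B.B₀lo B.B₀hi j, v ∉ graphBall G w₀ (R - P.r₀) → v ∈ T)
    {N : ℕ} (hN : kk * (Δ + 1) ^ (2 * rs) ≤ N) (hk : (1 - (q : ℝ) ^ (1 + Δ * cS + cS * cU)) ^ kk ≤ δ)
    -- THE INPUTS AT EVERY CENTRE: zone, short exit links, the bridge event
    (hzone : ∀ c, 1 - δ ^ 2 < (bondPercolation G q).real (UniqZone.zone G (Λc c) kz Mz))
    (hexit : ∀ c (i : Fin 2) (σ₀ : ℤˣ), 1 - δ ^ 2 < (bondPercolation G q).real (linkIn (↑(Rg c) : Set V) (Λc c kz) (Pex i σ₀ c)))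
    (hbridge : ∀ c, 1 - δ ^ 2 < (bondPercolation G q).real (linkIn (↑(Qb c) : Set V) (Λc c kz) (Fb c))) :
    ∃ (σ' : SData V) (S : Finset V),
      SHyp (winLData G (rootFrame φ t σ) w₀ R B.B₀lo B.B₀hi o Sfin) j σ' ∧ σ'.N ≤ N ∧ (1 - (q : ℝ) ^ σ'.sB) ^ σ'.k ≤ δ ∧
      S ⊆ (winLData G (rootFrame φ t σ) w₀ R B.B₀lo B.B₀hi o Sfin).X j ∧ S ⊆ Dr ∧
      (∀ x ∈ σ'.K, ∀ e ∈ σ'.seed x, e ∉ wireSet (↑S : Set V)) ∧ (∀ x ∈ σ'.K, σ'.face x ⊆ S) ∧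
      (∀ x ∈ σ'.K, 1 - 3 * δ ≤ (prodBernoulli Wt).real {ω | ∃ u ∈ σ'.face x,
        1 - δ < (prodBernoulli (pinW Wt (wireSet (↑S : Set V)) ω)).real (⋃ t ∈ T, openConnIn (↑Dr : Set V) u t)}) := by
  set ψ := rootFrame φ t σ with hψ
  set SF := rootSideU (φ := φ) t hσ (B.B₀lo - (j : Site 2)) (B.B₀hi + (j : Site 2)) with hSF
  have hKeq : winLevel G ψ w₀ R B.B₀lo B.B₀hi j = Win G ψ w₀ (Finset.Icc (B.B₀lo - (j : Site 2)) (B.B₀hi + (j : Site 2))) R := rfl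
  -- the frame facts used for the reach
  have hlip : Lip G ψ := lip_rootFrame hlipφ t hσ
  have hq : QStepsN G ψ P.N := (qStepsN_of_steps (steps_rootFrame hstep t hσ)).mono hPN
  have hU1 : (1 : ℤ) ≤ 1 := le_rfl
  have haff : ∀ (i : Fin 2) (σ₀ : ℤˣ), (SF i σ₀).IsAffine 1 ((fun _ _ => (1 : ℤ)) i σ₀) := fun i σ₀ => by
    rw [hSF]; exact rootSideU_isAffine t hσ _ _ i σ₀
  have hC : ∀ (i : Fin 2) (σ₀ : ℤˣ), ((1 : ℕ) : ℤ) ≤ (fun _ _ => (1 : ℤ)) i σ₀ := fun _ _ => by simp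
  have hU : (1 : ℤ) ≤ ((0 + 1 : ℕ) : ℤ) * (1 : ℕ) := by simp
  have hA' : P.A = ((Mz + 1 : ℕ) : ℤ) * 1 + 1 := by rw [hA]; push_cast; ring
  have hKCmax' : (shellD P + Mz + 1) * (0 + 1) ≤ KCmax := by simpa using hKCmax
  have hKC := hKC_of_affine SF haff hU1 P (le_refl 1) hC hU hA' hKCmax'
  refine kitClause_rootFrameG hlipφ hstep hfr hκ hΔ hδ t hσ P hPN hA hd1 hD1 hD2 hDρ hℓ hW hKmax hKCmax hR' hwide hdw hDw hT hT'
    hr₀ hR hrs hcS Rg hRg hRgcard hcU1 Λc kz hkn hΛ Pex hPex kk o Sfin hWD hXD hN hk (fun x hx hfar => ?_) (fun x hx hnear => ?_)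
  · -- FAR: the inner neighbour lies in the level and outside `B(w₀, R − r₀)`
    refine hfarT _ ?_ hfar
    have h := inNbr_spec (G := G) (φ := ψ) (by rw [hKeq] at hx; exact hx)
    rw [hKeq]
    exact (mem_Win G ψ).2 ⟨h.2.1, h.2.2⟩
  · -- NEAR: zone, exit link, bridge route datum at the kit centre
    refine Or.inr ⟨hzone _, hexit _ _ _, ?_⟩
    have hx' : x ∈ outerBoundary (winGraph G w₀ R) (Win G ψ w₀ (Finset.Icc (B.B₀lo - (j : Site 2)) (B.B₀hi + (j : Site 2))) R) := by
      rw [hKeq] at hx; exact hx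
    set c := ctCtr G SF P w₀ R x with hc
    -- the centre's frame image and window position
    have hcI : ψ c ∈ Finset.Icc (B.B₀lo - ((B.R' : ℕ) : Site 2)) (B.B₀hi + ((B.R' : ℕ) : Site 2)) :=
      ψ_ctCtr_mem_Icc SF hlip hq hstep hwide (fun i σ₀ z h1 h2 => hKC i σ₀ z h1) hE hx
    have hcw : c ∈ graphBall G w₀ (R - r) := by
      have hd := ctCtr_reach SF hlip hq hstep hwide (fun i σ₀ z h1 h2 => hKC i σ₀ z h1) hx'
      have h := BoxProdZ2.mem_graphBall_add G hnear hd
      exact graphBall_mono G _ (by omega) h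
    exact routeSets_bridge t σ B hcI hcw hr hrR (hQb c) (hFb c) (hFZ c) hPD hPT hWD (hbridge c)

end Skelφ

end Summit.CriticalPhenomena.PercolationContinuityZ3.Theorems.Transplant

end
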